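import Literature.NumberTheory.EllipticCurves.Rank1Residual.CyclotomicWindingSpan
import Literature.NumberTheory.EllipticCurves.PAdicLFunctionDistributionHoldsProofs
import Literature.NumberTheory.EllipticCurves.PAdicLFunctionIntegralityProofs
import Literature.NumberTheory.EllipticCurves.PAdicLFunctionInterpolationHoldsProofs
import Literature.NumberTheory.EllipticCurves.PAdicLFunctionNeZeroProofs
import Literature.NumberTheory.EllipticCurves.ModPReducibilityProofs
import Literature.NumberTheory.EllipticCurves.PAdicLFunctionProofs
import Literature.NumberTheory.EllipticCurves.PAdicLFunctionIntegralityAtTwoProofs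
import Literature.NumberTheory.EllipticCurves.FormalGroupDictionaryProofs
import HarnessLib

/-!
# The modular-symbol half of the `p = 3` collapse — stub 3a of LINE `theoremB-x10b`
# (crux `PrintX10b.AnalyticMuZeroX10b`, stmt-BirchSwinnertonDyer-20682)

Cell bsd-f3-mu; mathematics and kernel text by seat `-an` g5 (MEMO-an §12.1; HOME/an/g5/CollapseThree.lean sha16
689428c33c6cbfa6, `lean check` rc 0, 0 sorry, no named-fact hypotheses), landed by the lead prover p1 (§A–§C + the stub;
the `±4^s` bridge §D of the source is not needed here — stub 3b `stub_muAnZero_of_unitMeasure` is landed separately,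
`PrintX10bAnalyticMuZeroX10bStubMuAnZeroOfUnitMeasure.lean`).  Namespace `Summit.BirchSwinnertonDyer.BirchSwinnertonDyer.Theorems.CollapseThree`.

For an odd good ordinary prime `p` of `E = W`, `E[p]` irreducible, `f` a newform of `W`, `α` the unit root and
`μ = msdMeasure f α` the Mazur–Swinnerton-Dyer measure:
  `CycWindingNonConstantAt W p` ⟹ some value `μ(b + p^{n+1} ℤ_p)` at a UNIT residue `b` has norm `≥ 1`
(`exists_isUnit_one_le_norm_msdMeasure_of_cycWindingNonConstantAt`).  Contrapositive (`core`, pure `ℚ_p`-algebra):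
if every unit-residue value of `μ` lies in `pℤ_p`, then `[a/pⁿ]⁺ ≡ α⁻ⁿ[0]⁺`, the Hecke relation at `r = 0` gives
`(α − 1)² [0]⁺ ≡ 0`, whence `[x]⁺ ≡ [0]⁺ (mod p)` for every `x ∈ ℤ[1/p]` — the plus symbol is constant mod `p`.
Inputs, all PROVED tree theorems: `unitRoot_coe_spec`, `not_dvd_level_of_isNewformOf`,
`cuspCoeff_eq_frobeniusTrace_of_isNewformOf_holds`, `ratCast_ratPlusSymbol_holds`, `intCast_mul_ratPlusSymbol` (MTT (4.2)),
`ratPlusSymbol_add_intCast_eq`, `exists_intCast_mul_modularSymbol_zero_mem` + `norm_ratPlusSymbol_le_one` (p-integrality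
of `[0]⁺` for `E[p]` irreducible, `p ≠ 2`).
The last declaration is the registered stub `…Cruxes.AnalyticMuZeroX10b.TheoremB.stub_unitMeasure_of_nonconstancy`
(skeleton sha16 41c1930e4741df0b), by name and verbatim signature.

References: MEMO-an §12.1 (cell bsd-f3-mu); [MazurTateTeitelbaum1986Invent] §I.4 (4.2), §I.10 (10.1)–(10.2), §I.11.
-/

noncomputable section

open scoped Classical
open CongruenceSubgroup WeierstrassCurve
open Literature.NumberTheory.EllipticCurves
open Literature.NumberTheory.EllipticCurves.ModularForms
open Literature.NumberTheory.EllipticCurves.Rank1Residual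

namespace Summit.BirchSwinnertonDyer.BirchSwinnertonDyer.Theorems.CollapseThree

-- every declaration of this sub-problem lives under `Summit.BirchSwinnertonDyer.BirchSwinnertonDyer.…`
-- (summit = sub-problem name, D-0017), which the `dupNamespace` linter flags by design:
set_option linter.dupNamespace false

/-! ### §A  Ultrametric bookkeeping in `ℚ_p` -/

section Ultra

variable {p : ℕ} [Fact p.Prime]

/-- Ultrametric: `‖x‖, ‖y‖ < 1 ⟹ ‖x − y‖ < 1` in `ℚ_p`. [folklore] -/
theorem norm_sub_lt_one {x y : ℚ_[p]} (hx : ‖x‖ < 1) (hy : ‖y‖ < 1) : ‖x - y‖ < 1 := by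
  rw [sub_eq_add_neg]; exact padic_norm_add_lt_one hx (by rwa [norm_neg])

/-- Ultrametric: `‖x‖, ‖y‖ ≤ 1 ⟹ ‖x + y‖ ≤ 1` in `ℚ_p`. [folklore] -/
theorem norm_add_le_one {x y : ℚ_[p]} (hx : ‖x‖ ≤ 1) (hy : ‖y‖ ≤ 1) : ‖x + y‖ ≤ 1 :=
  (Padic.nonarchimedean x y).trans (max_le hx hy)

/-- Ultrametric: a finite sum of elements of norm `< 1` has norm `< 1` in `ℚ_p`. [folklore] -/
theorem norm_sum_lt_one {ι : Type*} (s : Finset ι) (g : ι → ℚ_[p]) (h : ∀ i ∈ s, ‖g i‖ < 1) :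
    ‖∑ i ∈ s, g i‖ < 1 :=
  Finset.sum_induction g (fun x => ‖x‖ < 1) (fun _ _ => padic_norm_add_lt_one) (by simp) h

/-- `‖u^k − 1‖ < 1` when `‖u − 1‖ < 1` and `‖u‖ ≤ 1`. -/
theorem norm_pow_sub_one_lt_one {u : ℚ_[p]} (hu : ‖u‖ ≤ 1) (h1 : ‖u - 1‖ < 1) (k : ℕ) :
    ‖u ^ k - 1‖ < 1 := by
  rw [← geom_sum_mul u k, norm_mul]
  have hs : ‖∑ i ∈ Finset.range k, u ^ i‖ ≤ 1 :=
    Finset.sum_induction _ (fun x => ‖x‖ ≤ 1) (fun _ _ => norm_add_le_one) (by simp)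
      fun i _ => by rw [norm_pow]; exact pow_le_one₀ (norm_nonneg _) hu
  calc ‖∑ i ∈ Finset.range k, u ^ i‖ * ‖u - 1‖ ≤ 1 * ‖u - 1‖ := by gcongr
    _ < 1 := by rw [one_mul]; exact h1

end Ultra

/-! ### §B  The abstract core: constancy of `[·]⁺ mod p` from small unit-residue measure values -/

section Core

variable {p : ℕ} [Fact p.Prime]

/-- The CORE (pure `ℚ_p`-algebra).  `X : ℚ → ℚ_p` `ℤ`-periodic (`[r+z]⁺ = [r]⁺`), `‖α‖ = 1`,
`α² − aα + p = 0`, `‖X 0‖ ≤ 1`, the Hecke relation at `0` (`a X(0) = Σ_{j mod p} X(j/p) + X(0)`), and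
`‖X(m/p^{n+1}) − α⁻¹ X(m/pⁿ)‖ < 1` for all `p ∤ m` (all unit-residue values of `μ_{f,α}` in `pℤ_p`)
force `‖X(b/pⁿ) − X(b'/pⁿ)‖ < 1` for all `b, b' ∈ ℤ`, `n ≥ 0`. -/
theorem core (X : ℚ → ℚ_[p]) (α : ℚ_[p]) (a : ℤ)
    (hper : ∀ (r : ℚ) (z : ℤ), X (r + z) = X r)
    (hα1 : ‖α‖ = 1) (hroot : α ^ 2 - (a : ℚ_[p]) * α + p = 0) (hX0 : ‖X 0‖ ≤ 1)
    (hHecke : (a : ℚ_[p]) * X 0 = ∑ j : Fin p, X ((j : ℚ) / p) + X 0)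
    (H : ∀ (n : ℕ) (m : ℕ), ¬ p ∣ m →
      ‖X ((m : ℚ) / (p : ℚ) ^ (n + 1)) - α⁻¹ * X ((m : ℚ) / (p : ℚ) ^ n)‖ < 1) :
    ∀ (n : ℕ) (b b' : ℤ), ‖X ((b : ℚ) / (p : ℚ) ^ n) - X ((b' : ℚ) / (p : ℚ) ^ n)‖ < 1 := by
  have hp : p.Prime := Fact.out
  have hα0 : α ≠ 0 := fun h => by rw [h, norm_zero] at hα1; exact zero_ne_one hα1
  have hαi : ‖α⁻¹‖ = 1 := by rw [norm_inv, hα1, inv_one]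
  -- L1: `X(m/pⁿ) ≡ α⁻ⁿ X(0)` for `p ∤ m`
  have L1 : ∀ m : ℕ, ¬ p ∣ m → ∀ n : ℕ,
      ‖X ((m : ℚ) / (p : ℚ) ^ n) - α⁻¹ ^ n * X 0‖ < 1 := by
    intro m hm n
    induction n with
    | zero =>
      have : X ((m : ℚ) / (p : ℚ) ^ 0) = X 0 := by
        rw [pow_zero, div_one, ← hper 0 m]; simp
      rw [this, pow_zero, one_mul, sub_self, norm_zero]; exact one_pos
    | succ n ih =>
      have hsplit : X ((m : ℚ) / (p : ℚ) ^ (n + 1)) - α⁻¹ ^ (n + 1) * X 0 =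
          (X ((m : ℚ) / (p : ℚ) ^ (n + 1)) - α⁻¹ * X ((m : ℚ) / (p : ℚ) ^ n)) +
            α⁻¹ * (X ((m : ℚ) / (p : ℚ) ^ n) - α⁻¹ ^ n * X 0) := by ring
      rw [hsplit]
      refine padic_norm_add_lt_one (H n m hm) ?_
      rw [norm_mul, hαi, one_mul]; exact ih
  -- L2: `(α − 1)² X(0) ≡ 0`, from the Hecke relation at `0`
  have L2 : ‖(α - 1) ^ 2 * X 0‖ < 1 := by
    have h0mem : (0 : Fin p) ∈ (Finset.univ : Finset (Fin p)) := Finset.mem_univ _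
    have hsum := Finset.add_sum_erase Finset.univ (fun j : Fin p => X ((j : ℚ) / p)) h0mem
    have hX00 : X (((0 : Fin p) : ℚ) / p) = X 0 := by simp
    rw [hX00] at hsum
    -- the `p − 1` nonzero residues
    set S : Finset (Fin p) := Finset.univ.erase 0 with hS
    have hcard : S.card = p - 1 := by
      rw [hS, Finset.card_erase_of_mem h0mem, Finset.card_univ, Fintype.card_fin]
    have hsmall : ∀ j ∈ S, ‖X ((j : ℚ) / p) - α⁻¹ * X 0‖ < 1 := by
      intro j hj
      have hj0 : (j : ℕ) ≠ 0 := by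
        intro h; rw [hS, Finset.mem_erase] at hj; exact hj.1 (Fin.ext h)
      have hjp : ¬ p ∣ (j : ℕ) := fun h => hj0 (Nat.eq_zero_of_dvd_of_lt h j.isLt)
      have := L1 j hjp 1
      simpa using this
    have hS_sum : ∑ j ∈ S, (X ((j : ℚ) / p) - α⁻¹ * X 0) =
        ((a : ℚ_[p]) - 2) * X 0 - ((p : ℚ_[p]) - 1) * (α⁻¹ * X 0) := by
      rw [Finset.sum_sub_distrib, Finset.sum_const, hcard, nsmul_eq_mul]
      have h1 : ∑ j ∈ S, X ((j : ℚ) / p) = (a : ℚ_[p]) * X 0 - 2 * X 0 := by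
        rw [hHecke, ← hsum]; ring
      rw [h1, Nat.cast_sub hp.one_le, Nat.cast_one]; ring
    have hlt : ‖((a : ℚ_[p]) - 2) * X 0 - ((p : ℚ_[p]) - 1) * (α⁻¹ * X 0)‖ < 1 := by
      rw [← hS_sum]; exact norm_sum_lt_one S _ hsmall
    have hid : (α - 1) ^ 2 * X 0 =
        α * (((a : ℚ_[p]) - 2) * X 0 - ((p : ℚ_[p]) - 1) * (α⁻¹ * X 0)) := by
      have hαα : α * α⁻¹ = 1 := mul_inv_cancel₀ hα0
      linear_combination X 0 * hroot + (((p : ℚ_[p]) - 1) * X 0) * hαα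
    rw [hid, norm_mul, hα1, one_mul]; exact hlt
  -- Q: `(α⁻ᵏ − 1) X(0) ≡ 0` for every `k` (dichotomy on `‖α − 1‖`)
  have Q : ∀ k : ℕ, ‖(α⁻¹ ^ k - 1) * X 0‖ < 1 := by
    intro k
    have hle : ‖α - 1‖ ≤ 1 := by
      have := Padic.nonarchimedean α (-1)
      rw [← sub_eq_add_neg, norm_neg, norm_one, hα1, max_self] at this; exact this
    rcases hle.lt_or_eq with hlt | heq
    · -- `α ≡ 1`: `‖α⁻ᵏ − 1‖ < 1`, `‖X 0‖ ≤ 1`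
      have h1 : ‖α⁻¹ - 1‖ < 1 := by
        have : α⁻¹ - 1 = α⁻¹ * (1 - α) := by field_simp
        rw [this, norm_mul, hαi, one_mul, norm_sub_rev]; exact hlt
      have hk := norm_pow_sub_one_lt_one hαi.le h1 k
      rw [norm_mul]
      calc ‖α⁻¹ ^ k - 1‖ * ‖X 0‖ ≤ ‖α⁻¹ ^ k - 1‖ * 1 := by gcongr
        _ < 1 := by rw [mul_one]; exact hk
    · -- `α ≢ 1`: `‖X 0‖ < 1`
      have hX0lt : ‖X 0‖ < 1 := by
        have := L2; rwa [norm_mul, norm_pow, heq, one_pow, one_mul] at this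
      have hk : ‖α⁻¹ ^ k - 1‖ ≤ 1 := by
        have := Padic.nonarchimedean (α⁻¹ ^ k) (-1)
        rw [← sub_eq_add_neg, norm_neg, norm_one, norm_pow, hαi, one_pow, max_self] at this
        exact this
      rw [norm_mul]
      calc ‖α⁻¹ ^ k - 1‖ * ‖X 0‖ ≤ 1 * ‖X 0‖ := by gcongr
        _ < 1 := by rw [one_mul]; exact hX0lt
  -- K: `X(m/pⁿ) ≡ X(0)` for every natural numerator `m`
  have K : ∀ (n : ℕ) (m : ℕ), ‖X ((m : ℚ) / (p : ℚ) ^ n) - X 0‖ < 1 := by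
    intro n
    induction n with
    | zero =>
      intro m
      have : X ((m : ℚ) / (p : ℚ) ^ 0) = X 0 := by
        rw [pow_zero, div_one, ← hper 0 m]; simp
      rw [this, sub_self, norm_zero]; exact one_pos
    | succ n ih =>
      intro m
      by_cases hm : p ∣ m
      · obtain ⟨c, rfl⟩ := hm
        have hp0 : (p : ℚ) ≠ 0 := Nat.cast_ne_zero.mpr hp.ne_zero
        have : ((p * c : ℕ) : ℚ) / (p : ℚ) ^ (n + 1) = (c : ℚ) / (p : ℚ) ^ n := by
          rw [Nat.cast_mul, pow_succ]; field_simp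
        rw [this]; exact ih c
      · have h1 := L1 m hm (n + 1)
        have h2 := Q (n + 1)
        have : X ((m : ℚ) / (p : ℚ) ^ (n + 1)) - X 0 =
            (X ((m : ℚ) / (p : ℚ) ^ (n + 1)) - α⁻¹ ^ (n + 1) * X 0) +
              (α⁻¹ ^ (n + 1) - 1) * X 0 := by ring
        rw [this]; exact padic_norm_add_lt_one h1 h2
  -- integer numerators reduce to natural ones by periodicity
  have K' : ∀ (n : ℕ) (b : ℤ), ‖X ((b : ℚ) / (p : ℚ) ^ n) - X 0‖ < 1 := by
    intro n b
    have hM : (0 : ℤ) < (p : ℤ) ^ n := pow_pos (Int.natCast_pos.mpr hp.pos) n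
    set M : ℤ := (p : ℤ) ^ n with hMdef
    have hdecomp : (b : ℚ) / (p : ℚ) ^ n = (((b % M).toNat : ℕ) : ℚ) / (p : ℚ) ^ n + (b / M : ℤ) := by
      have hnn : 0 ≤ b % M := Int.emod_nonneg b hM.ne'
      have hto : (((b % M).toNat : ℕ) : ℤ) = b % M := Int.toNat_of_nonneg hnn
      have hb : b = b % M + M * (b / M) := (Int.emod_add_mul_ediv b M).symm
      have hMQ : ((M : ℤ) : ℚ) = (p : ℚ) ^ n := by rw [hMdef]; push_cast; rfl
      have hp0 : (p : ℚ) ^ n ≠ 0 := pow_ne_zero _ (Nat.cast_ne_zero.mpr hp.ne_zero)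
      have : ((((b % M).toNat : ℕ) : ℤ) : ℚ) = ((b % M : ℤ) : ℚ) := by rw [hto]
      rw [Int.cast_natCast] at this
      rw [this]
      conv_lhs => rw [hb]
      push_cast
      rw [hMQ]; field_simp
    rw [hdecomp, hper]
    exact K n _
  intro n b b'
  have : X ((b : ℚ) / (p : ℚ) ^ n) - X ((b' : ℚ) / (p : ℚ) ^ n) =
      (X ((b : ℚ) / (p : ℚ) ^ n) - X 0) - (X ((b' : ℚ) / (p : ℚ) ^ n) - X 0) := by ring
  rw [this]; exact norm_sub_lt_one (K' n b) (K' n b')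

end Core

/-! ### §C  The wrapper: unit-residue values of `μ_{f,α}` for the newform of `E` -/

section Wrapper

variable {p : ℕ} [Fact p.Prime]

/-- `μ_{f,α}(m + p^{n+1}ℤ_p)` with an UNREDUCED natural numerator `m` (periodicity `[r+z]⁺ = [r]⁺`). -/
theorem msdMeasure_succ_natCast {N : ℕ} [NeZero N] (f : CuspForm (Gamma0 N) 2) (α : ℚ_[p])
    (n m : ℕ) :
    msdMeasure f α (n + 1) (m : ZMod (p ^ (n + 1))) =
      α⁻¹ ^ (n + 1) * ((ratPlusSymbol f ((m : ℚ) / (p : ℚ) ^ (n + 1)) : ℚ) : ℚ_[p]) -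
        α⁻¹ ^ (n + 2) * ((ratPlusSymbol f ((m : ℚ) / (p : ℚ) ^ n) : ℚ) : ℚ_[p]) := by
  have hp : p.Prime := Fact.out
  have hp0 : (p : ℚ) ≠ 0 := Nat.cast_ne_zero.mpr hp.ne_zero
  simp only [msdMeasure, ZMod.val_natCast]
  have hperN : ∀ (r : ℚ) (q : ℕ), ratPlusSymbol f (r + q) = ratPlusSymbol f r := fun r q => by
    exact_mod_cast ratPlusSymbol_add_intCast_eq f r q
  have hm : (m : ℚ) = ((m % p ^ (n + 1) : ℕ) : ℚ) + (p : ℚ) ^ (n + 1) * ((m / p ^ (n + 1) : ℕ) : ℚ) := by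
    have := (Nat.mod_add_div m (p ^ (n + 1))).symm
    exact_mod_cast this
  have h1 : (m : ℚ) / (p : ℚ) ^ (n + 1) =
      ((m % p ^ (n + 1) : ℕ) : ℚ) / (p : ℚ) ^ (n + 1) + ((m / p ^ (n + 1) : ℕ) : ℚ) := by
    rw [hm]; field_simp
  have h2 : (m : ℚ) / (p : ℚ) ^ n =
      ((m % p ^ (n + 1) : ℕ) : ℚ) / (p : ℚ) ^ n + ((p * (m / p ^ (n + 1)) : ℕ) : ℚ) := by
    rw [hm]; push_cast; field_simp; ring
  rw [h1, h2, hperN, hperN]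

/-- **The modular-symbol half of the collapse** (MEMO-an §12.1; any ODD good ordinary `p`, `E[p]`
irreducible): non-constancy of `[·]⁺_f mod p` on `ℤ[1/p]` (`CycWindingNonConstantAt W p`) forces a
unit-residue value `μ_{f,α}(b + p^{n+1}ℤ_p)`, `b ∈ (ℤ/p^{n+1})ˣ`, of norm `≥ 1` (hence `= 1` by
`norm_msdMeasure_le_one`).  Used: `unitRoot_coe_spec`, `not_dvd_level_of_isNewformOf`,
`cuspCoeff_eq_frobeniusTrace_of_isNewformOf_holds`, `ratCast_ratPlusSymbol_holds`,
`intCast_mul_ratPlusSymbol` (Hecke relation, MTT (4.2)), `ratPlusSymbol_add_intCast_eq`,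
`exists_intCast_mul_modularSymbol_zero_mem` + `norm_ratPlusSymbol_le_one` (p-integrality of `[0]⁺`,
this is where `E[p]` irreducible and `p ≠ 2` enter), and the abstract `core`. -/
theorem exists_isUnit_one_le_norm_msdMeasure_of_cycWindingNonConstantAt (hp2 : p ≠ 2)
    (W : WeierstrassCurve ℚ) [W.IsElliptic] [W.IsGloballyMinimal] {N : ℕ} [NeZero N]
    (f : CuspForm (Gamma0 N) 2) (hord : IsOrdinaryAt W p) (hf : IsNewformOf W f)
    (hirr : W.HasIrreducibleModPGaloisRep p) (hnc : CycWindingNonConstantAt W p) :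
    ∃ (n : ℕ) (b : ZMod (p ^ (n + 1))), IsUnit b ∧
      1 ≤ ‖msdMeasure f (unitRoot W p : ℚ_[p]) (n + 1) b‖ := by
  by_contra hcon
  push Not at hcon
  have hp : p.Prime := Fact.out
  obtain ⟨hroot, hα1, hα0⟩ := unitRoot_coe_spec (W := W) hord
  set α : ℚ_[p] := (unitRoot W p : ℚ_[p]) with hαdef
  have hαi : ‖α⁻¹‖ = 1 := by rw [norm_inv, hα1, inv_one]
  have hgood : W.HasGoodReductionAtPrime p := hord.1
  have hpN : ¬ p ∣ N := not_dvd_level_of_isNewformOf hf hgood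
  have hQ := hf.coeffField_eq_bot
  have hap : cuspCoeff f p = ((W.frobeniusTrace p : ℤ) : ℂ) :=
    cuspCoeff_eq_frobeniusTrace_of_isNewformOf_holds hf hgood
  have hrat : ∀ r : ℚ, (ratPlusSymbol f r : ℝ) = normalizedPlusSymbol f r :=
    fun r => ratCast_ratPlusSymbol_holds hf.1 hQ r
  set X : ℚ → ℚ_[p] := fun r => ((ratPlusSymbol f r : ℚ) : ℚ_[p]) with hXdef
  have hper : ∀ (r : ℚ) (z : ℤ), X (r + z) = X r := fun r z => by
    simp only [hXdef, ratPlusSymbol_add_intCast_eq]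
  -- `p`-integrality of `[0]⁺` (irreducibility)
  obtain ⟨n₀, hpn₀, h0⟩ :=
    exists_intCast_mul_modularSymbol_zero_mem not_irreducible_of_frobeniusTrace_congr_holds hf hirr
  have hX0 : ‖X 0‖ ≤ 1 := norm_ratPlusSymbol_le_one f hp2 hpn₀ h0 (by simp)
  -- the Hecke relation at `r = 0`
  have hHecke : ((W.frobeniusTrace p : ℤ) : ℚ_[p]) * X 0 = ∑ j : Fin p, X ((j : ℚ) / p) + X 0 := by
    have h := intCast_mul_ratPlusSymbol (p := p) hf.1 hp hpN hap hrat 0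
    simp only [zero_add, mul_zero] at h
    have h' := congrArg (fun q : ℚ => (q : ℚ_[p])) h
    simp only [Rat.cast_mul, Rat.cast_intCast, Rat.cast_add, Rat.cast_sum] at h'
    simpa [hXdef] using h'
  -- the hypothesis of the core from `hcon`
  have H : ∀ (n m : ℕ), ¬ p ∣ m →
      ‖X ((m : ℚ) / (p : ℚ) ^ (n + 1)) - α⁻¹ * X ((m : ℚ) / (p : ℚ) ^ n)‖ < 1 := by
    intro n m hm
    have hu : IsUnit ((m : ℕ) : ZMod (p ^ (n + 1))) := by
      rw [ZMod.isUnit_iff_coprime]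
      exact Nat.Coprime.pow_right _ ((Nat.Prime.coprime_iff_not_dvd hp).mpr hm).symm
    have h := hcon n _ hu
    have key : msdMeasure f α (n + 1) ((m : ℕ) : ZMod (p ^ (n + 1))) =
        α⁻¹ ^ (n + 1) * (X ((m : ℚ) / (p : ℚ) ^ (n + 1)) - α⁻¹ * X ((m : ℚ) / (p : ℚ) ^ n)) := by
      rw [msdMeasure_succ_natCast]; simp only [hXdef]; ring
    rw [key, norm_mul, norm_pow, hαi, one_pow, one_mul] at h
    exact h
  have hall := core X α (W.frobeniusTrace p) hper hα1 hroot hX0 hHecke H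
  obtain ⟨n, b, b', hge⟩ := hnc f hf
  have hlt := hall n b b'
  rw [Rat.cast_sub] at hge
  exact absurd hge (not_le.mpr hlt)

/-- The `p = 3` instance (the class X10b prime): for `E` good ordinary at `3` with `E[3]`
irreducible, `CycWindingNonConstantAt W 3` gives a unit residue `b mod 3^{n+1}` with
`‖μ_{f,α}(b + 3^{n+1}ℤ₃)‖ ≥ 1`. -/
theorem exists_isUnit_one_le_norm_msdMeasure_three
    (W : WeierstrassCurve ℚ) [W.IsElliptic] [W.IsGloballyMinimal] {N : ℕ} [NeZero N]
    (f : CuspForm (Gamma0 N) 2) (hord : IsOrdinaryAt W 3) (hf : IsNewformOf W f)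
    (hirr : W.HasIrreducibleModPGaloisRep 3) (hnc : CycWindingNonConstantAt W 3) :
    ∃ (n : ℕ) (b : ZMod (3 ^ (n + 1))), IsUnit b ∧
      1 ≤ ‖msdMeasure f (unitRoot W 3 : ℚ_[3]) (n + 1) b‖ :=
  exists_isUnit_one_le_norm_msdMeasure_of_cycWindingNonConstantAt (by decide) W f hord hf hirr hnc

end Wrapper

end Summit.BirchSwinnertonDyer.BirchSwinnertonDyer.Theorems.CollapseThree

/-! ### Stub 3a of LINE `theoremB-x10b` (crux stmt-BirchSwinnertonDyer-20682), by name and verbatim signature -/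

namespace Summit.BirchSwinnertonDyer.BirchSwinnertonDyer.Cruxes.AnalyticMuZeroX10b.TheoremB

-- `Summit.<Summit>.<Sub>.…` with Summit = Sub (D-0017): the linter flags it by design
set_option linter.dupNamespace false

/-- **Stub 3a `stub_unitMeasure_of_nonconstancy` of the registered skeleton (sha16 41c1930e4741df0b) of LINE
`theoremB-x10b` on crux `PrintX10b.AnalyticMuZeroX10b`**: for 3-ordinary `W` with newform `f` and `E[3]` irreducible,
non-constancy of `x ↦ [x]⁺ mod 3` on `ℤ[1/3]` yields a UNIT value of the Mazur–Swinnerton-Dyer measure `μ_{f,α}` on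
some ball `a + 3^{m+1}ℤ₃` with `a` a unit.  Proved outright (no named facts) by
`CollapseThree.exists_isUnit_one_le_norm_msdMeasure_of_cycWindingNonConstantAt` at `p = 3` (cell bsd-f3-mu, seat -an g5).
[cite: MazurTateTeitelbaum1986Invent, §I.10 (10.1)–(10.2)] -/
theorem stub_unitMeasure_of_nonconstancy :
    ∀ (W : WeierstrassCurve ℚ) [W.IsElliptic] [W.IsGloballyMinimal] {N : ℕ} [NeZero N] (f : CuspForm (Gamma0 N) 2),
      IsOrdinaryAt W 3 → IsNewformOf W f → W.HasIrreducibleModPGaloisRep 3 → CycWindingNonConstantAt W 3 →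
        ∃ (m : ℕ) (a : ZMod (3 ^ (m + 1))), IsUnit a ∧ 1 ≤ ‖msdMeasure f (unitRoot W 3 : ℚ_[3]) (m + 1) a‖ :=
  fun W _ _ _ _ f hord hf hirr hnc =>
    Summit.BirchSwinnertonDyer.BirchSwinnertonDyer.Theorems.CollapseThree.exists_isUnit_one_le_norm_msdMeasure_of_cycWindingNonConstantAt
      (p := 3) (by decide) W f hord hf hirr hnc

end Summit.BirchSwinnertonDyer.BirchSwinnertonDyer.Cruxes.AnalyticMuZeroX10b.TheoremB

end
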